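import Mathlib
import Summits.Parity.BatemanHorn.Theses.SelbergDelangeRigidity
import Literature.NumberTheory.Sieve.BatemanHornProofs
import Literature.NumberTheory.Sieve.ParityWave0BunyakovskyProofs
import HarnessLib

/-!
# Route SelbergDelangeRigidity, item `CoefficientExtraction` (stmt-Parity-9772) — proved

Bookkeeping at the `k`-fold zero of `Γ(z)⁻ᵏ`.  For a Bateman–Horn system `f = (f₁,…,f_k)` write
`Ω_f(n) = Σᵢ Ω(fᵢ(n))`, `H_x(z) = x⁻¹ e^{k(1-z) log log x} Σ_{n ≤ x} z^{Ω_f(n)}` and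
`Ψ(z) = Λ(z) e^{(z-1) log D} Γ(z)⁻ᵏ` with `D = ∏ deg fᵢ`, `Λ` holomorphic on `|z| < 2`,
`Λ(0) = C(f)`.  The item: `H_x^{(k)}(0) → Ψ^{(k)}(0)` implies `BatemanHornAsymptotic f`.

* `Ψ^{(k)}(0) = k! Λ(0)/D` (`iteratedDeriv_limit`): `Γ(z)⁻¹ = z Γ(z+1)⁻¹`
  (`Complex.one_div_Gamma_eq_self_mul_one_div_Gamma_add_one`), so `Ψ(z) = zᵏ G(z)` with `G`
  smooth at `0`, `G(0) = Λ(0)/D`, and the Leibniz rule.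
* `H_x^{(k)}(0) = x⁻¹ e^{ka} Σ_{i ≤ k} C(k,i) (−ka)^i (k−i)! π_{k−i}(x)` with `a = log log x` and
  `π_j(x) = #{n ≤ x : Ω_f(n) = j}` (`iteratedDeriv_family`, Leibniz rule again).
* for `n ≥ n₀(f)` all `fᵢ(n) ≥ 2`, hence `Ω_f(n) ≥ k` with equality iff all `fᵢ(n)` are prime
  (`exists_forall_two_le_eval`, `le_sum_cardFactors`); so `π_j(x) ≤ n₀` for `j < k` and
  `|π_k(x) − polyPrimeCount f x| ≤ n₀` (`card_bounds`).
* real analysis (`real_limit`): the terms `i ≥ 1` are `O((log log x)^i (log x)^k / x) → 0`, so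
  `(log x)^k x⁻¹ polyPrimeCount f x → C(f)/D`, which is the `IsEquivalent` of
  `BatemanHornAsymptotic f` since `C(f) > 0` (`IsBatemanHornSystem.hasBatemanHornConst_holds`)
  and `D ≥ 1` (`IsBatemanHornSystem.natDegree_pos`).
-/

open Filter Finset Polynomial
open scoped Topology BigOperators

namespace Summit.Parity.BatemanHorn.Theorems

namespace CoefficientExtraction

/-! ### The two iterated derivatives -/

/-- `dᵏ/dzᵏ (zᵏ · G(z))` at `z = 0` is `k! · G(0)` for `G` of class `Cᵏ` at `0`. -/
theorem iteratedDeriv_pow_mul (k : ℕ) {G : ℂ → ℂ} (hG : ContDiffAt ℂ k G 0) :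
    iteratedDeriv k (fun z : ℂ => z ^ k * G z) 0 = (k.factorial : ℂ) * G 0 := by
  rw [iteratedDeriv_fun_mul (by fun_prop) hG]
  simp only [iteratedDeriv_fun_pow_zero]
  rw [Finset.sum_eq_single k]
  · simp
  · intro i _ hik
    simp [hik]
  · intro hk
    exact absurd (Finset.mem_range.mpr (Nat.lt_succ_self k)) hk

/-- The limit side: `dᵏ/dzᵏ [Λ(z) e^{(z-1) log D} Γ(z)⁻ᵏ]` at `0` equals `k! Λ(0)/D`, because
`Γ(z)⁻¹ = z Γ(z+1)⁻¹` has a simple zero at `0`. -/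
theorem iteratedDeriv_limit (k : ℕ) {Λ : ℂ → ℂ} (hΛ : DifferentiableOn ℂ Λ (Metric.ball 0 2))
    {D : ℝ} (hD : 0 < D) :
    iteratedDeriv k (fun z : ℂ => Λ z * Complex.exp ((z - 1) * (Real.log D : ℂ)) *
        (Complex.Gamma z)⁻¹ ^ k) 0 = (k.factorial : ℂ) * Λ 0 / D := by
  have hfun : (fun z : ℂ => Λ z * Complex.exp ((z - 1) * (Real.log D : ℂ)) *
        (Complex.Gamma z)⁻¹ ^ k)
      = fun z => z ^ k * (Λ z * Complex.exp ((z - 1) * (Real.log D : ℂ)) *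
          (Complex.Gamma (z + 1))⁻¹ ^ k) := by
    funext z
    rw [Complex.one_div_Gamma_eq_self_mul_one_div_Gamma_add_one, mul_pow]
    ring
  rw [hfun, iteratedDeriv_pow_mul]
  · have hexp : Complex.exp (-(Real.log D : ℂ)) = (D : ℂ)⁻¹ := by
      rw [Complex.exp_neg, ← Complex.ofReal_exp, Real.exp_log hD]
    simp only [zero_sub, neg_one_mul, zero_add, Complex.Gamma_one, inv_one, one_pow, mul_one]
    rw [hexp]
    ring
  · have h1 : ContDiffAt ℂ k Λ 0 :=
      (hΛ.analyticAt (Metric.isOpen_ball.mem_nhds (Metric.mem_ball_self (by norm_num)))).contDiffAt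
    have h2 : ContDiffAt ℂ k (fun z : ℂ => Complex.exp ((z - 1) * (Real.log D : ℂ))) 0 := by
      fun_prop
    have hd : Differentiable ℂ (fun z : ℂ => (Complex.Gamma (z + 1))⁻¹ ^ k) :=
      (Complex.differentiable_one_div_Gamma.comp (f := fun z : ℂ => z + 1)
        (differentiable_id.add_const 1)).pow k
    have h3 : ContDiffAt ℂ k (fun z : ℂ => (Complex.Gamma (z + 1))⁻¹ ^ k) 0 :=
      hd.contDiff.contDiffAt
    exact (h1.mul h2).mul h3

/-- The family side: for constants `c, a`, a finite set `s` and an exponent map `g`,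
`dᵏ/dzᵏ [c · e^{k(1-z)a} · Σ_{n ∈ s} z^{g n}]` at `0` by the Leibniz rule, grouped by the value
`j = k - i` of `g`. -/
theorem iteratedDeriv_family (k : ℕ) (c a : ℂ) (s : Finset ℕ) (g : ℕ → ℕ) :
    iteratedDeriv k (fun z : ℂ => c * Complex.exp ((k : ℂ) * (1 - z) * a) *
        ∑ n ∈ s, z ^ (g n)) 0
      = c * Complex.exp (k * a) * ∑ i ∈ Finset.range (k + 1),
          (k.choose i : ℂ) * (-(k * a)) ^ i *
            ((k - i).factorial * #(s.filter (fun n => g n = k - i))) := by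
  have hE : (fun z : ℂ => c * Complex.exp ((k : ℂ) * (1 - z) * a))
      = fun z => (c * Complex.exp (k * a)) * Complex.exp ((-(k * a)) * z) := by
    funext z
    rw [mul_assoc c, ← Complex.exp_add]
    congr 2
    ring
  have hEd : ∀ i : ℕ, iteratedDeriv i (fun z : ℂ => c * Complex.exp ((k : ℂ) * (1 - z) * a)) 0
      = c * Complex.exp (k * a) * (-(k * a)) ^ i := by
    intro i
    rw [hE, iteratedDeriv_const_mul _ (by fun_prop), iteratedDeriv_cexp_const_mul]
    simp
  have hSd : ∀ j : ℕ, iteratedDeriv j (fun z : ℂ => ∑ n ∈ s, z ^ (g n)) 0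
      = (j.factorial : ℂ) * #(s.filter (fun n => g n = j)) := by
    intro j
    rw [iteratedDeriv_fun_sum (fun n _ => by fun_prop)]
    simp only [iteratedDeriv_fun_pow_zero, Nat.cast_ite, Nat.cast_zero]
    calc ∑ n ∈ s, (if j = g n then ((g n).factorial : ℂ) else 0)
        = ∑ n ∈ s, (if g n = j then (j.factorial : ℂ) else 0) := by
          refine Finset.sum_congr rfl fun n _ => ?_
          by_cases h : g n = j
          · simp [h]
          · simp [h, Ne.symm h]
      _ = (j.factorial : ℂ) * #(s.filter (fun n => g n = j)) := by
          rw [← Finset.sum_filter, Finset.sum_const, nsmul_eq_mul, mul_comm]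
  rw [iteratedDeriv_fun_mul (by fun_prop) (by fun_prop), Finset.mul_sum]
  refine Finset.sum_congr rfl fun i _ => ?_
  rw [hEd, hSd]
  ring

/-! ### Real analysis: the lower-order terms are negligible -/

/-- `(log log x)^m (log x)^k / x → 0`, written with `e^{k log log x}` for `(log x)^k`. -/
theorem tendsto_aux (m k : ℕ) :
    Tendsto (fun x : ℝ => x⁻¹ * Real.exp (k * Real.log (Real.log x)) *
      Real.log (Real.log x) ^ m) atTop (𝓝 0) := by
  have hmain : Tendsto (fun x : ℝ => Real.log x ^ (k + m) / x) atTop (𝓝 0) := by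
    have := Real.tendsto_pow_log_div_mul_add_atTop 1 0 (k + m) one_ne_zero
    simpa only [one_mul, add_zero] using this
  refine tendsto_of_tendsto_of_tendsto_of_le_of_le' tendsto_const_nhds hmain ?_ ?_
  · filter_upwards [eventually_ge_atTop (Real.exp 1)] with x hx
    have hx0 : 0 < x := (Real.exp_pos 1).trans_le hx
    have hlog : 1 ≤ Real.log x := by
      have := Real.log_le_log (Real.exp_pos 1) hx
      rwa [Real.log_exp] at this
    have hll : 0 ≤ Real.log (Real.log x) := Real.log_nonneg hlog
    exact mul_nonneg (mul_nonneg (inv_nonneg.mpr hx0.le) (Real.exp_pos _).le) (pow_nonneg hll m)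
  · filter_upwards [eventually_ge_atTop (Real.exp 1)] with x hx
    have hx0 : 0 < x := (Real.exp_pos 1).trans_le hx
    have hlog : 1 ≤ Real.log x := by
      have := Real.log_le_log (Real.exp_pos 1) hx
      rwa [Real.log_exp] at this
    have hlogpos : 0 < Real.log x := one_pos.trans_le hlog
    have hll0 : 0 ≤ Real.log (Real.log x) := Real.log_nonneg hlog
    have hll : Real.log (Real.log x) ≤ Real.log x :=
      (Real.log_le_sub_one_of_pos hlogpos).trans (by linarith)
    rw [← Real.log_pow, Real.exp_log (pow_pos hlogpos k), pow_add, div_eq_mul_inv]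
    have hpow : Real.log (Real.log x) ^ m ≤ Real.log x ^ m := pow_le_pow_left₀ hll0 hll m
    calc x⁻¹ * Real.log x ^ k * Real.log (Real.log x) ^ m
        ≤ x⁻¹ * Real.log x ^ k * Real.log x ^ m := by gcongr
      _ = Real.log x ^ k * Real.log x ^ m * x⁻¹ := by ring

/-- Same, along `ℕ` and with the signed power `(-(k log log x))^m`. -/
theorem tendsto_aux' (m k : ℕ) :
    Tendsto (fun x : ℕ => (x : ℝ)⁻¹ * Real.exp (k * Real.log (Real.log x)) *
      (-(k * Real.log (Real.log x))) ^ m) atTop (𝓝 0) := by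
  have h := ((tendsto_aux m k).comp tendsto_natCast_atTop_atTop).const_mul ((-(k : ℝ)) ^ m)
  rw [mul_zero] at h
  refine h.congr fun x => ?_
  simp only [Function.comp_apply]
  rw [← neg_mul, mul_pow]
  ring

/-- The extraction in real terms: if `π_j(x) ≤ n₀` for `j < k`, `|P(x) − π_k(x)| ≤ n₀`, and
`x⁻¹ e^{ka} Σ_{i ≤ k} C(k,i) (−ka)^i (k−i)! π_{k−i}(x) → k! c` (`a = log log x`), then
`(log x)^k x⁻¹ P(x) → c`. -/
theorem real_limit (k n₀ : ℕ) (c : ℝ) (π : ℕ → ℕ → ℕ) (P : ℕ → ℕ)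
    (h1 : ∀ j < k, ∀ x, π j x ≤ n₀)
    (h2 : ∀ x, (P x : ℝ) ≤ π k x + n₀ ∧ (π k x : ℝ) ≤ P x + n₀)
    (h3 : Tendsto (fun x : ℕ => (x : ℂ)⁻¹ * Complex.exp (k * (Real.log (Real.log x) : ℂ)) *
      ∑ i ∈ Finset.range (k + 1), (k.choose i : ℂ) * (-(k * (Real.log (Real.log x) : ℂ))) ^ i *
        ((k - i).factorial * (π (k - i) x : ℂ))) atTop (𝓝 (k.factorial * (c : ℂ)))) :
    Tendsto (fun x : ℕ => Real.log x ^ k / x * (P x : ℝ)) atTop (𝓝 c) := by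
  -- bounded × negligible → 0
  have hB : ∀ (m : ℕ) (b : ℕ → ℝ), (∀ x, |b x| ≤ n₀) →
      Tendsto (fun x : ℕ => (x : ℝ)⁻¹ * Real.exp (k * Real.log (Real.log x)) *
        (-(k * Real.log (Real.log x))) ^ m * b x) atTop (𝓝 0) := by
    intro m b hb
    refine (tendsto_aux' m k).zero_mul_isBoundedUnder_le
      (Filter.isBoundedUnder_of ⟨(n₀ : ℝ), fun x => ?_⟩)
    simpa [Real.norm_eq_abs] using hb x
  -- the hypothesis in real terms
  have h3r : Tendsto (fun x : ℕ => (x : ℝ)⁻¹ * Real.exp (k * Real.log (Real.log x)) *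
      ∑ i ∈ Finset.range (k + 1), (k.choose i : ℝ) * (-(k * Real.log (Real.log x))) ^ i *
        ((k - i).factorial * (π (k - i) x : ℝ))) atTop (𝓝 (k.factorial * c)) := by
    refine tendsto_ofReal_iff.mp ?_
    push_cast
    exact h3
  -- the terms `i ≥ 1` tend to `0`
  have hR : Tendsto (fun x : ℕ => ∑ i ∈ Finset.range k,
      (x : ℝ)⁻¹ * Real.exp (k * Real.log (Real.log x)) *
        ((k.choose (i + 1) : ℝ) * (-(k * Real.log (Real.log x))) ^ (i + 1) *
          ((k - (i + 1)).factorial * (π (k - (i + 1)) x : ℝ)))) atTop (𝓝 0) := by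
    rw [show (0 : ℝ) = ∑ i ∈ Finset.range k, (0 : ℝ) by simp]
    refine tendsto_finsetSum _ fun i hi => ?_
    have hik : k - (i + 1) < k := by
      have := Finset.mem_range.mp hi
      omega
    have hb : ∀ x, |(π (k - (i + 1)) x : ℝ)| ≤ n₀ := fun x => by
      rw [abs_of_nonneg (Nat.cast_nonneg _)]
      exact_mod_cast h1 _ hik x
    have h := (hB (i + 1) _ hb).const_mul ((k.choose (i + 1) : ℝ) * (k - (i + 1)).factorial)
    rw [mul_zero] at h
    refine h.congr fun x => ?_
    ring
  -- peel off the term `i = 0`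
  have h4 : Tendsto (fun x : ℕ => (x : ℝ)⁻¹ * Real.exp (k * Real.log (Real.log x)) *
      ((k.factorial : ℝ) * π k x)) atTop (𝓝 (k.factorial * c)) := by
    have h := h3r.sub hR
    rw [sub_zero] at h
    refine h.congr fun x => ?_
    rw [Finset.sum_range_succ', mul_add, Finset.mul_sum, add_sub_cancel_left]
    simp only [Nat.choose_zero_right, Nat.cast_one, pow_zero, one_mul, Nat.sub_zero]
  -- divide by `k!`
  have h5 : Tendsto (fun x : ℕ => (x : ℝ)⁻¹ * Real.exp (k * Real.log (Real.log x)) *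
      (π k x : ℝ)) atTop (𝓝 c) := by
    have hk : (k.factorial : ℝ) ≠ 0 := by positivity
    have h := h4.const_mul ((k.factorial : ℝ)⁻¹)
    rw [inv_mul_cancel_left₀ hk] at h
    refine h.congr fun x => ?_
    calc (k.factorial : ℝ)⁻¹ * ((x : ℝ)⁻¹ * Real.exp (k * Real.log (Real.log x)) *
          ((k.factorial : ℝ) * π k x))
        = ((k.factorial : ℝ)⁻¹ * k.factorial) *
            ((x : ℝ)⁻¹ * Real.exp (k * Real.log (Real.log x)) * π k x) := by ring
      _ = _ := by rw [inv_mul_cancel₀ hk, one_mul]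
  -- replace `π k` by `P`
  have h6 : Tendsto (fun x : ℕ => (x : ℝ)⁻¹ * Real.exp (k * Real.log (Real.log x)) *
      (P x : ℝ)) atTop (𝓝 c) := by
    have hb : ∀ x, |((P x : ℝ) - π k x)| ≤ n₀ := fun x =>
      abs_sub_le_iff.mpr ⟨by linarith [(h2 x).1], by linarith [(h2 x).2]⟩
    have h := h5.add (hB 0 (fun x => (P x : ℝ) - π k x) hb)
    rw [add_zero] at h
    refine h.congr fun x => ?_
    simp only [pow_zero, mul_one]
    ring
  -- `e^{k log log x} = (log x)^k` for `x ≥ 2`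
  refine h6.congr' ?_
  filter_upwards [eventually_ge_atTop 2] with x hx
  have hx1 : (1 : ℝ) < x := by exact_mod_cast hx
  have hlog : 0 < Real.log x := Real.log_pos hx1
  rw [← Real.log_pow, Real.exp_log (pow_pos hlog k)]
  ring

/-! ### Counting: `Ω_f(n) = k` iff all `fᵢ(n)` are prime, for `n ≥ n₀` -/

/-- For a Bateman–Horn system, all values `fᵢ(n)`, `n ∈ ℕ`, are eventually `≥ 2`. -/
theorem exists_forall_two_le_eval {k : ℕ} {f : Fin k → ℤ[X]}
    (hf : Literature.NumberTheory.Sieve.IsBatemanHornSystem f) :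
    ∃ n₀ : ℕ, ∀ n, n₀ ≤ n → ∀ i, (2 : ℤ) ≤ (f i).eval (n : ℤ) := by
  have h : ∀ᶠ n : ℕ in atTop, ∀ i, (2 : ℤ) ≤ (f i).eval (n : ℤ) :=
    Filter.eventually_all.mpr fun i =>
      (Literature.NumberTheory.Sieve.tendsto_eval_natCast_atTop
        (Nat.succ_le_of_lt (hf.natDegree_pos i)) (hf.leadingCoeff_pos i)).eventually_ge_atTop 2
  exact Filter.eventually_atTop.mp h

/-- If all `fᵢ(n) ≥ 2` then `Ω_f(n) = Σᵢ Ω(fᵢ(n)) ≥ k`, with equality iff every `fᵢ(n)` is a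
(positive) prime. -/
theorem le_sum_cardFactors {k : ℕ} {f : Fin k → ℤ[X]} {n : ℕ}
    (hn : ∀ i, (2 : ℤ) ≤ (f i).eval (n : ℤ)) :
    k ≤ ∑ i, ArithmeticFunction.cardFactors (((f i).eval (n : ℤ)).toNat) ∧
    ((∑ i, ArithmeticFunction.cardFactors (((f i).eval (n : ℤ)).toNat)) = k ↔
      ∀ i, 0 < (f i).eval (n : ℤ) ∧ (((f i).eval (n : ℤ)).toNat).Prime) := by
  have hone : ∀ i, 1 ≤ ArithmeticFunction.cardFactors (((f i).eval (n : ℤ)).toNat) := fun i =>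
    ArithmeticFunction.cardFactors_pos_iff_one_lt.mpr (Int.lt_toNat.mpr (by
      have := hn i
      push_cast
      omega))
  have hk : (∑ _i : Fin k, (1 : ℕ)) = k := by simp
  constructor
  · calc k = ∑ _i : Fin k, (1 : ℕ) := hk.symm
      _ ≤ _ := Finset.sum_le_sum fun i _ => hone i
  · rw [show ((∑ i, ArithmeticFunction.cardFactors (((f i).eval (n : ℤ)).toNat)) = k) ↔
        ((∑ _i : Fin k, (1 : ℕ)) = ∑ i, ArithmeticFunction.cardFactors (((f i).eval (n : ℤ)).toNat))
        from by rw [hk, eq_comm],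
      Finset.sum_eq_sum_iff_of_le (fun i _ => hone i)]
    simp only [Finset.mem_univ, true_implies]
    refine forall_congr' fun i => ?_
    rw [eq_comm, ArithmeticFunction.cardFactors_eq_one_iff_prime]
    exact ⟨fun h => ⟨by linarith [hn i], h⟩, fun h => h.2⟩

/-- The counts `π_j(x) = #{n ≤ x : Ω_f(n) = j}` versus `polyPrimeCount f x`: `π_j(x) ≤ n₀` for
`j < k` and `|π_k(x) − polyPrimeCount f x| ≤ n₀`. -/
theorem card_bounds {k : ℕ} {f : Fin k → ℤ[X]} {n₀ : ℕ}
    (hn₀ : ∀ n, n₀ ≤ n → ∀ i, (2 : ℤ) ≤ (f i).eval (n : ℤ)) (x : ℕ) :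
    (∀ j < k, #((Finset.range (x + 1)).filter
        (fun n : ℕ => ∑ i, ArithmeticFunction.cardFactors (((f i).eval (n : ℤ)).toNat) = j)) ≤ n₀) ∧
    Literature.NumberTheory.Sieve.polyPrimeCount f x ≤ #((Finset.range (x + 1)).filter
        (fun n : ℕ => ∑ i, ArithmeticFunction.cardFactors (((f i).eval (n : ℤ)).toNat) = k)) + n₀ ∧
    #((Finset.range (x + 1)).filter
        (fun n : ℕ => ∑ i, ArithmeticFunction.cardFactors (((f i).eval (n : ℤ)).toNat) = k)) ≤
      Literature.NumberTheory.Sieve.polyPrimeCount f x + n₀ := by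
  refine ⟨fun j hj => ?_, ?_, ?_⟩
  · calc #((Finset.range (x + 1)).filter
          (fun n : ℕ => ∑ i, ArithmeticFunction.cardFactors (((f i).eval (n : ℤ)).toNat) = j))
        ≤ #(Finset.range n₀) := Finset.card_le_card fun n hn => ?_
      _ = n₀ := Finset.card_range n₀
    rw [Finset.mem_filter] at hn
    rw [Finset.mem_range]
    by_contra hlt
    push Not at hlt
    have := (le_sum_cardFactors (hn₀ n hlt)).1
    omega
  · unfold Literature.NumberTheory.Sieve.polyPrimeCount
    refine (Finset.card_le_card_sdiff_add_card (t := Finset.range n₀)).trans ?_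
    rw [Finset.card_range]
    refine Nat.add_le_add_right (Finset.card_le_card fun n hn => ?_) _
    rw [Finset.mem_sdiff, @Finset.mem_filter _ _ (_), Finset.mem_range, Finset.mem_range] at hn
    rw [Finset.mem_filter, Finset.mem_range]
    push Not at hn
    exact ⟨hn.1.1, (le_sum_cardFactors (hn₀ n hn.2)).2.mpr hn.1.2⟩
  · unfold Literature.NumberTheory.Sieve.polyPrimeCount
    refine (Finset.card_le_card_sdiff_add_card (t := Finset.range n₀)).trans ?_
    rw [Finset.card_range]
    refine Nat.add_le_add_right (Finset.card_le_card fun n hn => ?_) _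
    rw [Finset.mem_sdiff, Finset.mem_filter, Finset.mem_range, Finset.mem_range] at hn
    rw [@Finset.mem_filter _ _ (_), Finset.mem_range]
    push Not at hn
    exact ⟨hn.1.1, (le_sum_cardFactors (hn₀ n hn.2)).2.mp hn.1.2⟩

end CoefficientExtraction

open CoefficientExtraction in
/-- **Item `CoefficientExtraction` of route SelbergDelangeRigidity (stmt-Parity-9772), proved**:
for a Bateman–Horn system `f = (f₁, …, f_k)`, a function `Λ` holomorphic on `|z| < 2` with
`Λ(0) = C(f)`, and convergence of the `k`-th `z`-derivatives at `0` of
`H_x(z) = x⁻¹ e^{k(1-z) log log x} Σ_{n ≤ x} z^{Ω_f(n)}` to that of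
`Ψ(z) = Λ(z) e^{(z-1) log ∏ deg fᵢ} Γ(z)⁻ᵏ`, the Bateman–Horn asymptotic
`polyPrimeCount f x ~ C(f)/(∏ deg fᵢ) · x/(log x)^k` holds (Selberg–Delange coefficient
extraction at the `k`-fold zero of `Γ(z)⁻ᵏ`, cf. Tenenbaum, *Introduction to analytic and
probabilistic number theory*, II.6). -/
theorem coefficientExtraction_proof :
    Summit.Parity.BatemanHorn.Theses.SelbergDelangeRigidity.CoefficientExtraction := by
  intro k f hf Λ hΛ hΛ0 hT
  have hD : (0 : ℝ) < ∏ i, ((f i).natDegree : ℝ) :=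
    Finset.prod_pos fun i _ => by exact_mod_cast hf.natDegree_pos i
  obtain ⟨hC, hCpos⟩ :=
    Literature.NumberTheory.Sieve.IsBatemanHornSystem.hasBatemanHornConst_holds hf
  obtain ⟨n₀, hn₀⟩ := exists_forall_two_le_eval hf
  -- evaluate both iterated derivatives
  rw [iteratedDeriv_limit k hΛ hD, hΛ0] at hT
  have hx : ∀ x : ℕ, iteratedDeriv k (fun z : ℂ => (x : ℂ)⁻¹ *
      Complex.exp ((k : ℂ) * (1 - z) * (Real.log (Real.log x) : ℂ)) *
        ∑ n ∈ Finset.range (x + 1),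
          z ^ (∑ i, ArithmeticFunction.cardFactors (((f i).eval (n : ℤ)).toNat))) 0 = _ :=
    fun x => iteratedDeriv_family k ((x : ℂ)⁻¹) (Real.log (Real.log x) : ℂ)
      (Finset.range (x + 1))
      (fun n => ∑ i, ArithmeticFunction.cardFactors (((f i).eval (n : ℤ)).toNat))
  simp only [hx] at hT
  -- the real limit `(log x)^k x⁻¹ polyPrimeCount f x → C(f)/D`
  have hmain : Tendsto (fun x : ℕ => Real.log x ^ k / x *
      (Literature.NumberTheory.Sieve.polyPrimeCount f x : ℝ)) atTop
      (𝓝 (Literature.NumberTheory.Sieve.batemanHornConst f / ∏ i, ((f i).natDegree : ℝ))) := by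
    refine real_limit k n₀ _
      (fun j x => #((Finset.range (x + 1)).filter
        (fun n : ℕ => ∑ i, ArithmeticFunction.cardFactors (((f i).eval (n : ℤ)).toNat) = j)))
      (fun x => Literature.NumberTheory.Sieve.polyPrimeCount f x) ?_ ?_ ?_
    · intro j hj x
      exact (card_bounds hn₀ x).1 j hj
    · intro x
      obtain ⟨-, h2, h3⟩ := card_bounds hn₀ x
      exact ⟨by exact_mod_cast h2, by exact_mod_cast h3⟩
    · have e : ((k.factorial : ℂ) * ((Literature.NumberTheory.Sieve.batemanHornConst f /
          ∏ i, ((f i).natDegree : ℝ) : ℝ) : ℂ)) = k.factorial *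
          (Literature.NumberTheory.Sieve.batemanHornConst f : ℂ) /
            ((∏ i, ((f i).natDegree : ℝ) : ℝ) : ℂ) := by
        push_cast
        ring
      rw [e]
      exact hT
  -- conclude the asymptotic equivalence
  refine ⟨Literature.NumberTheory.Sieve.batemanHornConst f, hC, ?_⟩
  rw [Fintype.card_fin]
  have hC0 : Literature.NumberTheory.Sieve.batemanHornConst f ≠ 0 := hCpos.ne'
  have hD0 : (∏ i, ((f i).natDegree : ℝ)) ≠ 0 := hD.ne'
  refine Asymptotics.isEquivalent_of_tendsto_one ?_
  have h7 := hmain.const_mul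
    ((∏ i, ((f i).natDegree : ℝ)) / Literature.NumberTheory.Sieve.batemanHornConst f)
  rw [show (∏ i, ((f i).natDegree : ℝ)) / Literature.NumberTheory.Sieve.batemanHornConst f *
      (Literature.NumberTheory.Sieve.batemanHornConst f / ∏ i, ((f i).natDegree : ℝ)) = 1 by
    field_simp] at h7
  refine h7.congr' ?_
  filter_upwards [eventually_ge_atTop 2] with x hx
  have hx1 : (1 : ℝ) < x := by exact_mod_cast hx
  have hlog : Real.log x ≠ 0 := (Real.log_pos hx1).ne'
  have hx0 : (x : ℝ) ≠ 0 := by positivity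
  simp only [Pi.div_apply]
  field_simp

end Summit.Parity.BatemanHorn.Theorems
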